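import Literature.NumberTheory.EllipticCurves.IwasawaAlgebraCharIdealProofs
import HarnessLib

/-!
# Castella–Grossi–Skinner, Math. Ann. 393 (2025), §7.2 "Proof of Mazur's main conjecture": the
# CONGRUENCE ARGUMENT — its pure `Λ`-algebra cores, PROVED (no named fact)

Source: F. Castella, G. Grossi, C. Skinner, *Mazur's main conjecture at Eisenstein primes*, Math.
Ann. **393** (2025) 2451–2506 = arXiv:2303.04373v2 (bib key `CastellaGrossiSkinner2025`), §7.2,
final TeX `run/shared/lean/b2b/bsd-rank1-residual/b2b-bsdres-lit-cgls/src/cgs25-final/Mazur-paper_revised.tex`: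
proof of Lemma 7.2.2 (`lem:int-div-PR`, l.3328–3366) and proof of Theorem 7.2.3 (`thm:PR-IMC`,
l.3432–3447) [arXiv v1: Lemma 6.1.2 / Theorem 6.1.3, corpus `paper:arxiv-2303.04373` p0028]. Cell
`pub/bsd-littype` (typing layer D-0088(4)), seat `bsd-littype-02` gen 3; closes the cell's
open-question row OQ-12 of `pub/bsd-littype/OPEN-QUESTIONS-02.md` ("the pure-`Λ`-algebra core of the
congruence mechanism … as a proved lemma over `IwasawaAlgebra p`", consumer: `bsd-smallim`
(SmallImageMuTransfer), and any kernel assembly of Thm. 7.2.3 from Prop. 3.4.4 + Lemma 2.5.1).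

## The printed arguments (verbatim) and what is proved here

* Proof of **Theorem 7.2.3** (l.3436–3446): "we have the integral divisibility
  `ch_{Λ_K⁺}(𝔛_ord^S(E_•/K_∞⁺)) ⊃ (𝓛_p^PR(E_•/K)^{+,S})` in `Λ_K⁺`. Take a character `α … ≡ 1 (mod ϖ^m)`
  for some `m ≫ 0` … we have [display `eq:key-cong`, l.3443] `𝓕^S_ord(E_•/K_∞⁺) ≡ 𝓕^S_ord(E_•(α)/K_∞⁺) ≡ 𝓛_p^PR(E_•(α)/K)^{+,S} ≡
  𝓛_p^PR(E_•/K)^{+,S} (mod ϖ^m)` … Taking `m ≫ 0`, it follows from the congruence that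
  `𝓕^S_ord(E_•/K_∞⁺)` and `𝓛_p^PR(E_•/K)^{+,S}` have *the same* Iwasawa `λ`- and `μ`-invariants, and so
  equality holds in [the divisibility]." THE ALGEBRA (`span_singleton_eq_of_dvd_of_C_pow_dvd_sub`):
  in `A⟦T⟧`, `A` a local domain, `π ∈ A` prime: if `F ∣ L`, `π^{μ+1} ∤ F` (i.e. `μ(F) ≤ μ`), `μ < m`
  and `F ≡ L (mod π^m)`, then `(F) = (L)`. (Proof: `L = Fh`, `F(1 − h) ∈ π^m`, write `F = π^{μ_F}F₀`
  with `π ∤ F₀`; cancelling, `π ∣ F₀(1 − h)`, so `π ∣ 1 − h` by primality of `π` in `A⟦T⟧`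
  (`prime_C_of_prime`), whence `h(0) ∈ 1 + πA` is a unit and `h` is a unit. No Weierstrass
  preparation is needed; "same `λ` and `μ`" is the printed route to the same conclusion.)
* Proof of **Lemma 7.2.2** (l.3348–3366): "from the above we have [display `eq:div-h`, l.3342] `𝓕^S_ord(E_•(α)/K_∞⁺) · h =
  ϖ^k · 𝓛_p^PR(E_•(α)/K)^{+,S}` for some `h ∈ Λ_K⁺` and `k ∈ ℤ`. If `k < 0` there is nothing to show, so
  assume `k ≥ 0`. … the untwisted … integral divisibility `ch_{Λ_K⁺}(𝔛^S_ord(E_•/K_∞⁺)) ⊃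
  (𝓛_p^PR(E_•/K)^{+,S})` in `Λ_K⁺`. By the congruences of Proposition 3.4.4 and Lemma 2.5.1, it follows …
  that for `α` sufficiently close to `1` (i.e. taking `m > 0` … sufficiently large) the `μ`-invariant
  of `𝓕^S_ord(E_•(α)/K_∞⁺)` is at most that of `𝓛_p^PR(E_•(α)/K)^{+,S}`. Thus from (`eq:div-h`) we see that `h`
  is divisible by `ϖ^k`, and therefore the divisibility holds in `Λ_K⁺`." THE ALGEBRA
  (`C_pow_dvd_of_mul_eq_C_pow_mul`, `dvd_of_mul_eq_C_pow_mul`): if `F h = π^k L`, `μ(F)` is finite and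
  `μ(F) ≤ μ(L)` (every power of `π` dividing `F` divides `L`), then `π^k ∣ h` and hence `F ∣ L`; and the
  assembled printed step (`dvd_of_mul_eq_C_pow_mul_of_congruent`): `F ∣ L` integrally, `F ≡ F'`,
  `L ≡ L' (mod π^m)` with `m > μ(L)`, and `F' h = π^k L'` ⟹ `F' ∣ L'` (the `μ`-invariants transfer along
  the congruences: `C_pow_dvd_iff_of_C_pow_dvd_sub`).

Setting of the lemmas: `A⟦T⟧ = PowerSeries A` over a commutative DOMAIN `A` with a PRIME element `π`
(for the unit step also LOCAL); the printed rings are `Λ_K⁺ ≅ ℤ_p⟦T⟧` and `Λ_{K,R}⁺ = R⟦T⟧`, `R` the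
ring of integers of a finite extension of `ℚ_p` with uniformizer `ϖ` — complete DVRs, in particular
local domains with `ϖ` prime; the specialisations to the tree's `IwasawaAlgebra p = ℤ_p⟦T⟧` with
`π = p` (`IwasawaAlgebra.prime_C`) are recorded at the end. "`μ(F) ≤ μ`" is spelled
`¬ C π ^ (μ + 1) ∣ F` and "`F ≡ L (mod π^m)`" is `C π ^ m ∣ F − L` (ideal `π^m A⟦T⟧ = (C π)^m`).
Everything here is a theorem; no definition, no named fact, no `sorry`.

## References
* [CastellaGrossiSkinner2025] Math. Ann. 393 (2025): proof of Lemma 7.2.2 (l.3348–3366), proof of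
  Theorem 7.2.3 (l.3432–3447); Prop. 3.4.4 and Lemma 2.5.1 (the congruences fed in).
* L. Washington, *Introduction to Cyclotomic Fields*, §13.1–13.2 (`μ`, `λ`, `p` prime in `Λ`) — tree
  `IwasawaAlgebraCharIdealProofs.lean` (`prime_C_of_prime`, `IwasawaAlgebra.prime_C`).
-/

namespace Literature.NumberTheory.EllipticCurves.CastellaGrossiSkinner2025

open PowerSeries

variable {A : Type*} [CommRing A]

/-- **Exact `π`-adic order of a power series of finite `μ`-invariant**: if `π^{μ+1} ∤ F` then
`F = π^k · F₀` with `k ≤ μ` and `π ∤ F₀` (take `k` least with `π^{k+1} ∤ F`). The element-level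
`μ`-invariant `μ(F) = k` of CGS §7.2 ("the `μ`-invariant of `𝓕^S_ord(E_•(α)/K_∞⁺)`").
[cite: CastellaGrossiSkinner2025, §7.2, proof of Lemma 7.2.2 (l.3360–3366)] -/
theorem exists_eq_C_pow_mul_not_dvd {π : A} {F : A⟦X⟧} {μ : ℕ} (hμ : ¬ C π ^ (μ + 1) ∣ F) :
    ∃ k ≤ μ, ∃ F₀ : A⟦X⟧, F = C π ^ k * F₀ ∧ ¬ C π ∣ F₀ := by
  classical
  have hex : ∃ k, ¬ C π ^ (k + 1) ∣ F := ⟨μ, hμ⟩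
  obtain ⟨k₀, hk₀, hmin, hle⟩ :
      ∃ k₀, ¬ C π ^ (k₀ + 1) ∣ F ∧ (∀ j < k₀, C π ^ (j + 1) ∣ F) ∧ k₀ ≤ μ :=
    ⟨Nat.find hex, Nat.find_spec hex, fun j hj => by simpa using Nat.find_min hex hj,
      Nat.find_min' hex hμ⟩
  have hdvd : C π ^ k₀ ∣ F := by
    rcases Nat.eq_zero_or_pos k₀ with h0 | hpos
    · rw [h0, pow_zero]; exact one_dvd _
    · have := hmin (k₀ - 1) (by omega)
      rwa [Nat.sub_add_cancel hpos] at this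
  obtain ⟨F₀, hF₀⟩ := hdvd
  refine ⟨k₀, hle, F₀, hF₀, fun ⟨G, hG⟩ => hk₀ ⟨G, ?_⟩⟩
  rw [hF₀, hG, pow_succ, mul_assoc]

/-- **`μ`-invariants transfer along congruences**: if `F ≡ F' (mod π^m)` then for every `j ≤ m`,
`π^j ∣ F ↔ π^j ∣ F'`; so `μ(F) = μ(F')` as soon as `m > μ(F)` ("for `α` sufficiently close to `1` …
the `μ`-invariant of `𝓕^S_ord(E_•(α)/K_∞⁺)` is at most that of `𝓛_p^PR(E_•(α)/K)^{+,S}`", obtained in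
print from the congruences of Prop. 3.4.4 / Lemma 2.5.1 and the untwisted divisibility).
[cite: CastellaGrossiSkinner2025, §7.2, proof of Lemma 7.2.2 (l.3360–3366)] -/
theorem C_pow_dvd_iff_of_C_pow_dvd_sub {π : A} {F F' : A⟦X⟧} {m j : ℕ} (hj : j ≤ m)
    (hcong : C π ^ m ∣ F - F') : C π ^ j ∣ F ↔ C π ^ j ∣ F' := by
  have hj' : C π ^ j ∣ F - F' := (pow_dvd_pow _ hj).trans hcong
  constructor
  · intro h
    have := dvd_sub h hj'
    rwa [sub_sub_cancel] at this
  · intro h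
    have := dvd_add h hj'
    rwa [add_sub_cancel] at this

/-- **The algebra of the proof of Theorem 7.2.3** ("taking `m ≫ 0`, it follows from the congruence
… that `𝓕^S_ord(E_•/K_∞⁺)` and `𝓛_p^PR(E_•/K)^{+,S}` have the same Iwasawa `λ`- and `μ`-invariants,
and so equality holds in" the integral divisibility `ch ⊃ (𝓛)`): over a local domain `A` with a prime
`π`, if `F ∣ L` in `A⟦T⟧`, `π^{μ+1} ∤ F`, `μ < m` and `π^m ∣ F − L`, then `(F) = (L)` as ideals of
`A⟦T⟧`. Proof: `L = Fh`; `F = π^k F₀` with `π ∤ F₀`, `k ≤ μ`; from `π^m ∣ F(1 − h) = π^k F₀(1 − h)`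
and `m > k`, cancelling `π^k` (domain) gives `π ∣ F₀(1 − h)`, so `π ∣ 1 − h` (`C π` is prime,
`prime_C_of_prime`); then `h(0) ∈ 1 + πA` is a unit of the local ring `A`, so `h` is a unit of `A⟦T⟧`
(`PowerSeries.isUnit_iff_constantCoeff`). [cite: CastellaGrossiSkinner2025, §7.2, proof of Theorem 7.2.3 (l.3436–3446)] -/
theorem span_singleton_eq_of_dvd_of_C_pow_dvd_sub [IsDomain A] [IsLocalRing A] {π : A} (hπ : Prime π)
    {F L : A⟦X⟧} (hFL : F ∣ L) {μ m : ℕ} (hμ : ¬ C π ^ (μ + 1) ∣ F) (hm : μ < m)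
    (hcong : C π ^ m ∣ F - L) : Ideal.span {F} = Ideal.span {L} := by
  obtain ⟨k, hk, F₀, hF, hF₀⟩ := exists_eq_C_pow_mul_not_dvd hμ
  obtain ⟨h, rfl⟩ := hFL
  have hπC : Prime (C π : A⟦X⟧) := prime_C_of_prime hπ
  have hsplit : (C π : A⟦X⟧) ^ m = C π ^ k * (C π * C π ^ (m - k - 1)) := by
    rw [← pow_succ', ← pow_add]; congr 1; omega
  have h1 : C π ^ k * (C π * C π ^ (m - k - 1)) ∣ C π ^ k * (F₀ * (1 - h)) := by
    rw [← hsplit]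
    have : F - F * h = C π ^ k * (F₀ * (1 - h)) := by rw [hF]; ring
    rwa [this] at hcong
  have hne : (C π ^ k : A⟦X⟧) ≠ 0 := pow_ne_zero _ hπC.ne_zero
  have h2 : C π * C π ^ (m - k - 1) ∣ F₀ * (1 - h) := (mul_dvd_mul_iff_left hne).mp h1
  have h3 : (C π : A⟦X⟧) ∣ F₀ * (1 - h) := (dvd_mul_right _ _).trans h2
  obtain ⟨y, hy⟩ : (C π : A⟦X⟧) ∣ 1 - h := (hπC.dvd_or_dvd h3).resolve_left hF₀
  have hunit : IsUnit h := by
    rw [PowerSeries.isUnit_iff_constantCoeff]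
    have hh : h = 1 - C π * y := by rw [← hy]; ring
    rw [hh, map_sub, map_one, map_mul, PowerSeries.constantCoeff_C]
    refine IsLocalRing.isUnit_one_sub_self_of_mem_nonunits _ ?_
    rw [mem_nonunits_iff]
    exact fun hu => hπ.not_unit (isUnit_of_mul_isUnit_left hu)
  exact (Ideal.span_singleton_mul_right_unit hunit F).symm

/-- **The algebra of the proof of Lemma 7.2.2** ("Thus from `𝓕 · h = ϖ^k · 𝓛` we see that `h` is
divisible by `ϖ^k`"): in `A⟦T⟧`, `A` a domain with a prime `π`, if `F h = π^k L`, `π^{μ+1} ∤ F`, and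
every power of `π` dividing `F` divides `L` ("the `μ`-invariant of `𝓕` is at most that of `𝓛`"),
then `π^k ∣ h`. Proof: `F = π^j F₀`, `π ∤ F₀`; `π^j ∣ L`, `L = π^j L'`; cancelling, `F₀ h = π^k L'`, and
`π ∤ F₀` with `π` prime gives `π^k ∣ h` (`Prime.pow_dvd_of_dvd_mul_left`).
[cite: CastellaGrossiSkinner2025, §7.2, proof of Lemma 7.2.2 (l.3348–3366)] -/
theorem C_pow_dvd_of_mul_eq_C_pow_mul [IsDomain A] {π : A} (hπ : Prime π) {F L h : A⟦X⟧} {k μ : ℕ}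
    (hμ : ¬ C π ^ (μ + 1) ∣ F) (hmono : ∀ j : ℕ, C π ^ j ∣ F → C π ^ j ∣ L)
    (heq : F * h = C π ^ k * L) : C π ^ k ∣ h := by
  obtain ⟨j, -, F₀, hF, hF₀⟩ := exists_eq_C_pow_mul_not_dvd hμ
  obtain ⟨L', hL'⟩ := hmono j ⟨F₀, hF⟩
  have hπC : Prime (C π : A⟦X⟧) := prime_C_of_prime hπ
  have hne : (C π ^ j : A⟦X⟧) ≠ 0 := pow_ne_zero _ hπC.ne_zero
  have h1 : C π ^ j * (F₀ * h) = C π ^ j * (C π ^ k * L') := by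
    rw [← mul_assoc, ← hF, heq, hL']; ring
  have h2 : F₀ * h = C π ^ k * L' := mul_left_cancel₀ hne h1
  exact hπC.pow_dvd_of_dvd_mul_left k hF₀ ⟨L', h2⟩

/-- Under the hypotheses of `C_pow_dvd_of_mul_eq_C_pow_mul`, the RATIONAL divisibility
`F h = π^k L` is an INTEGRAL one: `F ∣ L` ("and therefore the divisibility holds in `Λ_K⁺`").
[cite: CastellaGrossiSkinner2025, §7.2, proof of Lemma 7.2.2 (l.3348–3366)] -/
theorem dvd_of_mul_eq_C_pow_mul [IsDomain A] {π : A} (hπ : Prime π) {F L h : A⟦X⟧} {k μ : ℕ}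
    (hμ : ¬ C π ^ (μ + 1) ∣ F) (hmono : ∀ j : ℕ, C π ^ j ∣ F → C π ^ j ∣ L)
    (heq : F * h = C π ^ k * L) : F ∣ L := by
  obtain ⟨h', rfl⟩ := C_pow_dvd_of_mul_eq_C_pow_mul hπ hμ hmono heq
  have hne : (C π ^ k : A⟦X⟧) ≠ 0 := pow_ne_zero _ (prime_C_of_prime hπ).ne_zero
  refine ⟨h', mul_left_cancel₀ hne ?_⟩
  rw [← heq]; ring

/-- **The printed step of Lemma 7.2.2, assembled**: `F ∣ L` integrally (the untwisted divisibility,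
Kato/Wuthrich), `π^{μ+1} ∤ L` (`μ(L)` finite, `≤ μ`), the congruences `F ≡ F'`, `L ≡ L' (mod π^m)`
with `m > μ` (Prop. 3.4.4 and Lemma 2.5.1 at `α ≡ 1 (mod ϖ^m)`, "`m` sufficiently large"), and the
rational divisibility `F' h = π^k L'` (Prop. 4.2.1 + Lemma 7.2.1 + the BF divisibility, via Cor.
3.3.3) ⟹ the INTEGRAL divisibility `F' ∣ L'`. (The `μ`-invariants transfer along the congruences,
`C_pow_dvd_iff_of_C_pow_dvd_sub`, then `dvd_of_mul_eq_C_pow_mul`.)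
[cite: CastellaGrossiSkinner2025, §7.2, Lemma 7.2.2 and its proof (l.3328–3366)] -/
theorem dvd_of_mul_eq_C_pow_mul_of_congruent [IsDomain A] {π : A} (hπ : Prime π) {F L F' L' h : A⟦X⟧}
    {k μ m : ℕ} (hFL : F ∣ L) (hL : ¬ C π ^ (μ + 1) ∣ L) (hm : μ < m)
    (hF' : C π ^ m ∣ F - F') (hL' : C π ^ m ∣ L - L') (heq : F' * h = C π ^ k * L') :
    F' ∣ L' := by
  have hF : ¬ C π ^ (μ + 1) ∣ F := fun h => hL (h.trans hFL)
  have hF'μ : ¬ C π ^ (μ + 1) ∣ F' :=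
    fun h => hF ((C_pow_dvd_iff_of_C_pow_dvd_sub (by omega) hF').mpr h)
  refine dvd_of_mul_eq_C_pow_mul hπ hF'μ (fun j hj => ?_) heq
  by_cases hjμ : j ≤ μ
  · have hjF : C π ^ j ∣ F := (C_pow_dvd_iff_of_C_pow_dvd_sub (by omega) hF').mpr hj
    exact (C_pow_dvd_iff_of_C_pow_dvd_sub (by omega) hL').mp (hjF.trans hFL)
  · exact absurd ((pow_dvd_pow _ (by omega : μ + 1 ≤ j)).trans hj) hF'μ

/-- **The printed step of Theorem 7.2.3, assembled** from the chain of congruences (display `eq:key-cong`, l.3443)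
`F ≡ F_α ≡ L_α ≡ L (mod π^m)` (Prop. 3.4.4, the equality `eq:alpha-equality` at `α` with Cor. 3.3.3, Lemma 2.5.1)
and the integral divisibility `F ∣ L`: if `π^{μ+1} ∤ F` and `m > μ` then `(F) = (L)`.
[cite: CastellaGrossiSkinner2025, §7.2, proof of Theorem 7.2.3 (l.3436–3446)] -/
theorem span_singleton_eq_of_dvd_of_congruent_chain [IsDomain A] [IsLocalRing A] {π : A} (hπ : Prime π)
    {F Fα Lα L : A⟦X⟧} (hFL : F ∣ L) {μ m : ℕ} (hμ : ¬ C π ^ (μ + 1) ∣ F) (hm : μ < m)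
    (h₁ : C π ^ m ∣ F - Fα) (h₂ : C π ^ m ∣ Fα - Lα) (h₃ : C π ^ m ∣ Lα - L) :
    Ideal.span {F} = Ideal.span {L} := by
  refine span_singleton_eq_of_dvd_of_C_pow_dvd_sub hπ hFL hμ hm ?_
  have := dvd_add (dvd_add h₁ h₂) h₃
  rwa [sub_add_sub_cancel, sub_add_sub_cancel] at this

/-! ### Specialisation to the Iwasawa algebra `Λ = ℤ_p⟦T⟧`, `π = p` -/

/-- Theorem 7.2.3's algebra in `Λ = ℤ_p⟦T⟧` (`IwasawaAlgebra p`), `π = p` (prime in `Λ`,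
`IwasawaAlgebra.prime_C`): `F ∣ L`, `p^{μ+1} ∤ F`, `μ < m`, `p^m ∣ F − L` ⟹ `(F) = (L)`.
[cite: CastellaGrossiSkinner2025, §7.2, proof of Theorem 7.2.3 (l.3436–3446)] -/
theorem iwasawaAlgebra_span_singleton_eq_of_dvd_of_congruent {p : ℕ} [Fact p.Prime]
    {F L : IwasawaAlgebra p} (hFL : F ∣ L) {μ m : ℕ}
    (hμ : ¬ PowerSeries.C ((p : ℤ_[p]) ^ (μ + 1)) ∣ F) (hm : μ < m)
    (hcong : PowerSeries.C ((p : ℤ_[p]) ^ m) ∣ F - L) : Ideal.span {F} = Ideal.span {L} := by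
  rw [map_pow] at hμ hcong
  exact span_singleton_eq_of_dvd_of_C_pow_dvd_sub PadicInt.prime_p hFL hμ hm hcong

/-- Lemma 7.2.2's algebra in `Λ = ℤ_p⟦T⟧`: `F h = p^k L`, `p^{μ+1} ∤ F`, `μ(F) ≤ μ(L)` ⟹ `F ∣ L`.
[cite: CastellaGrossiSkinner2025, §7.2, proof of Lemma 7.2.2 (l.3348–3366)] -/
theorem iwasawaAlgebra_dvd_of_mul_eq_C_pow_mul {p : ℕ} [Fact p.Prime]
    {F L h : IwasawaAlgebra p} {k μ : ℕ} (hμ : ¬ PowerSeries.C ((p : ℤ_[p]) ^ (μ + 1)) ∣ F)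
    (hmono : ∀ j : ℕ, PowerSeries.C ((p : ℤ_[p]) ^ j) ∣ F → PowerSeries.C ((p : ℤ_[p]) ^ j) ∣ L)
    (heq : F * h = PowerSeries.C ((p : ℤ_[p]) ^ k) * L) : F ∣ L := by
  rw [map_pow] at hμ heq
  exact dvd_of_mul_eq_C_pow_mul PadicInt.prime_p hμ
    (fun j hj => by simpa [map_pow] using hmono j (by simpa [map_pow] using hj)) heq

end Literature.NumberTheory.EllipticCurves.CastellaGrossiSkinner2025
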